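import Summits.CriticalPhenomena.Ising3DConformalLimit.Theorems.IsingEuclidUpgradeR2RotInvPowerLaw.Negative.LogPeriodicGauge
import HarnessLib

/-!
# Crux `IsingEuclidUpgradeR2RotInvPowerLaw` (stmt-CriticalPhenomena-0634) — negative-side support, II: the drifting gauge (W1)

Standing crux disprover (cdisprove cycle 1, 2026-08-17), THEOREM-ONLY file; finding F3 of
`Cruxes/IsingEuclidUpgradeR2RotInvPowerLaw/Disproof.lean`, split off for landing.

**Witness W1** (through defining hypotheses `hh`, `hG`, no definitions): the radial-by-floor kernel
`G x = h ⌊|x|₂⌋` with the DRIFTING axis gauge `h n = 1/(n (1 + log n))` (a logarithmic correction). It is positive,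
cubic symmetric, in the envelope (`‖x‖⁻²/3 ≤ G ≤ 2‖x‖⁻¹`), satisfies the integer dilation law S2 at `Δ = 1/2` for
EVERY `k`, ratio isotropy S3 and the angular profile statement A (`Ψ ≡ 1`) IDENTICALLY — and violates the dyadic
tower law T1, hence the axial law D1 and the crux shape.

* `dr_dyadicTowerLaw_not_of_dilation_isotropy_envelope` — {positivity, symmetry, envelope, S2, S3, A} ⊬ T1.
* `dr_crux_not_of_dilation_isotropy_envelope` — {positivity, symmetry, envelope, S2, S3, A} ⊬ crux shape.

Reading for the provers: the PURITY content of `stub_dyadicTowerLaw` (no slowly drifting factor along the single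
tower `2^j`) is invisible to S2, S3, A and the envelope; it is where the Ising hypothesis must enter a proof of T1.
-/

noncomputable section

namespace Summit.CriticalPhenomena.Ising3DConformalLimit.Theorems.IsingEuclidUpgradeR2RotInvPowerLaw.Negative

open Filter Topology Literature.Probability.LatticeModels
open Summit.CriticalPhenomena.Ising3DConformalLimit.Theorems.GapForcesFarMerging.Negative (one_le_norm_of_ne_zero)
open Summit.CriticalPhenomena.Ising3DConformalLimit.Cruxes.DirectCorrelationStableTail.DiffusiveBranchIsNonsaturation
  (expWin_norm_le_euclid expWin_euclid_le_sqrt_three_mul_norm)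

/-! ## The gauge `h n = 1/(n (1 + log n))` (hypothesis `hh`; value at `0` := value at `1`) -/

/-- The gauge off `0`. -/
theorem dr_of_one_le {h : ℕ → ℝ} (hh : ∀ n : ℕ, h n = 1 / (((max n 1 : ℕ) : ℝ) * (1 + Real.log ((max n 1 : ℕ) : ℝ)))) {n : ℕ} (hn : 1 ≤ n) : h n = 1 / ((n : ℝ) * (1 + Real.log n)) := by
  simp [hh, max_eq_left hn]

/-- `1 ≤ 1 + log (max n 1)`. -/
theorem dr_one_le_one_add_log_max (n : ℕ) : (1 : ℝ) ≤ 1 + Real.log ((max n 1 : ℕ) : ℝ) := by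
  have : (0 : ℝ) ≤ Real.log ((max n 1 : ℕ) : ℝ) := Real.log_nonneg (by exact_mod_cast le_max_right n 1)
  linarith

/-- The gauge is positive. -/
theorem dr_pos {h : ℕ → ℝ} (hh : ∀ n : ℕ, h n = 1 / (((max n 1 : ℕ) : ℝ) * (1 + Real.log ((max n 1 : ℕ) : ℝ)))) (n : ℕ) : 0 < h n := by
  rw [hh]
  have h1 := dr_one_le_one_add_log_max n
  have h2 : (1 : ℝ) ≤ ((max n 1 : ℕ) : ℝ) := by exact_mod_cast le_max_right n 1
  positivity

/-- Upper gauge bound `h n ≤ 1 / max n 1`. -/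
theorem dr_le {h : ℕ → ℝ} (hh : ∀ n : ℕ, h n = 1 / (((max n 1 : ℕ) : ℝ) * (1 + Real.log ((max n 1 : ℕ) : ℝ)))) (n : ℕ) : h n ≤ 1 / ((max n 1 : ℕ) : ℝ) := by
  rw [hh]
  have h1 := dr_one_le_one_add_log_max n
  have h2 : (1 : ℝ) ≤ ((max n 1 : ℕ) : ℝ) := by exact_mod_cast le_max_right n 1
  rw [one_div_le_one_div (by positivity) (by positivity)]
  nlinarith

/-- Lower gauge bound `1 / (max n 1)² ≤ h n` (`1 + log m ≤ m`). -/
theorem le_dr {h : ℕ → ℝ} (hh : ∀ n : ℕ, h n = 1 / (((max n 1 : ℕ) : ℝ) * (1 + Real.log ((max n 1 : ℕ) : ℝ)))) (n : ℕ) : 1 / ((max n 1 : ℕ) : ℝ) ^ 2 ≤ h n := by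
  rw [hh]
  have h2 : (1 : ℝ) ≤ ((max n 1 : ℕ) : ℝ) := by exact_mod_cast le_max_right n 1
  have h1 := dr_one_le_one_add_log_max n
  have h3 : 1 + Real.log ((max n 1 : ℕ) : ℝ) ≤ ((max n 1 : ℕ) : ℝ) := by
    have := Real.add_one_le_exp (Real.log ((max n 1 : ℕ) : ℝ))
    rw [Real.exp_log (by positivity)] at this
    linarith
  rw [one_div_le_one_div (by positivity) (by positivity), sq]
  gcongr

/-! ## The kernel `G x = h ⌊|x|₂⌋` (hypothesis `hG`) -/

/-- W1 is positive. -/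
theorem dr_G_pos {h : ℕ → ℝ} {G : Site 3 → ℝ} (hh : ∀ n : ℕ, h n = 1 / (((max n 1 : ℕ) : ℝ) * (1 + Real.log ((max n 1 : ℕ) : ℝ)))) (hG : ∀ x : Site 3, G x = h ⌊Real.sqrt (∑ i, ((x i : ℝ)) ^ 2)⌋₊) (x : Site 3) : 0 < G x := by
  rw [hG]; exact dr_pos hh _

/-! (On the axis `G (n e₀) = h n` and cubic symmetry hold for ANY radial-by-floor kernel: `lp_single`,
`lp_G_symm` of `Negative/LogPeriodicGauge.lean`, reused.) -/

/-- W1 satisfies ratio isotropy S3 — identically. -/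
theorem dr_ratioIsotropy {h : ℕ → ℝ} {G : Site 3 → ℝ} (hh : ∀ n : ℕ, h n = 1 / (((max n 1 : ℕ) : ℝ) * (1 + Real.log ((max n 1 : ℕ) : ℝ)))) (hG : ∀ x : Site 3, G x = h ⌊Real.sqrt (∑ i, ((x i : ℝ)) ^ 2)⌋₊) :
    Tendsto (fun x : Site 3 => G x / G (Pi.single 0 ((⌊Real.sqrt (∑ i, ((x i : ℝ)) ^ 2)⌋₊ : ℕ) : ℤ))) cofinite (𝓝 1) := by
  refine (tendsto_const_nhds (x := (1 : ℝ))).congr fun x => ?_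
  rw [lp_single hG, hG, div_self (dr_pos hh _).ne']

/-- W1 satisfies the angular profile statement A with `Ψ ≡ 1` — identically. -/
theorem dr_angularProfile {h : ℕ → ℝ} {G : Site 3 → ℝ} (hh : ∀ n : ℕ, h n = 1 / (((max n 1 : ℕ) : ℝ) * (1 + Real.log ((max n 1 : ℕ) : ℝ)))) (hG : ∀ x : Site 3, G x = h ⌊Real.sqrt (∑ i, ((x i : ℝ)) ^ 2)⌋₊) :
    Tendsto (fun x : Site 3 => G x / G (Pi.single 0 ((⌊Real.sqrt (∑ i, ((x i : ℝ)) ^ 2)⌋₊ : ℕ) : ℤ)) - (fun _ : Fin 3 → ℝ => (1 : ℝ)) (fun i => (x i : ℝ) / Real.sqrt (∑ j, ((x j : ℝ)) ^ 2))) cofinite (𝓝 0) := by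
  refine (tendsto_const_nhds (x := (0 : ℝ))).congr fun x => ?_
  rw [lp_single hG, hG, div_self (dr_pos hh _).ne', sub_self]

/-- W1 lies in the envelope: `‖x‖⁻²/3 ≤ G x ≤ 2‖x‖⁻¹`. -/
theorem dr_envelope {h : ℕ → ℝ} {G : Site 3 → ℝ} (hh : ∀ n : ℕ, h n = 1 / (((max n 1 : ℕ) : ℝ) * (1 + Real.log ((max n 1 : ℕ) : ℝ)))) (hG : ∀ x : Site 3, G x = h ⌊Real.sqrt (∑ i, ((x i : ℝ)) ^ 2)⌋₊) :
    (∃ c C : ℝ, 0 < c ∧ ∀ x : Site 3, x ≠ 0 → c * (‖x‖ : ℝ) ^ (-(2 : ℝ)) ≤ G x ∧ G x ≤ C * (‖x‖ : ℝ) ^ (-(1 : ℝ))) := by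
  refine ⟨1 / 3, 2, by norm_num, fun x hx => ?_⟩
  obtain ⟨hn1, hnr, hrn⟩ := floor_radius_bounds hx
  rw [hG]
  set r := Real.sqrt (∑ i, ((x i : ℝ)) ^ 2) with hr
  set n := ⌊r⌋₊ with hn
  have hx1 : (1 : ℝ) ≤ ‖x‖ := one_le_norm_of_ne_zero hx
  have hxr : ‖x‖ ≤ r := expWin_norm_le_euclid x
  have hr3 : r ≤ Real.sqrt 3 * ‖x‖ := expWin_euclid_le_sqrt_three_mul_norm x
  have hnpos : (0 : ℝ) < n := by exact_mod_cast hn1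
  have hmax : ((max n 1 : ℕ) : ℝ) = n := by rw [max_eq_left hn1]
  have hs3 : Real.sqrt 3 ^ 2 = 3 := Real.sq_sqrt (by norm_num)
  constructor
  · have h1 : 1 / (n : ℝ) ^ 2 ≤ h n := by simpa only [hmax] using le_dr hh n
    rw [Real.rpow_neg (by linarith), Real.rpow_two]
    calc 1 / 3 * (‖x‖ ^ 2)⁻¹ = 1 / ((Real.sqrt 3 * ‖x‖) ^ 2) := by rw [mul_pow, hs3]; field_simp
      _ ≤ 1 / r ^ 2 := by
          apply one_div_le_one_div_of_le (pow_pos (by linarith) 2)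
          exact pow_le_pow_left₀ (by linarith) hr3 2
      _ ≤ 1 / (n : ℝ) ^ 2 := by
          apply one_div_le_one_div_of_le (by positivity)
          exact pow_le_pow_left₀ hnpos.le hnr 2
      _ ≤ h n := h1
  · have h1 : h n ≤ 1 / (n : ℝ) := by simpa only [hmax] using dr_le hh n
    rw [Real.rpow_neg_one]
    calc h n ≤ 1 / (n : ℝ) := h1
      _ = 2 / (2 * (n : ℝ)) := by field_simp
      _ ≤ 2 / r := div_le_div_of_nonneg_left (by norm_num) (by linarith) hrn
      _ ≤ 2 / ‖x‖ := div_le_div_of_nonneg_left (by norm_num) (by linarith) hxr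
      _ = 2 * ‖x‖⁻¹ := by rw [div_eq_mul_inv]

/-- `(1 + u n)/(a + u n) → 1` when `u → +∞`. -/
theorem tendsto_one_add_div_add {u : ℕ → ℝ} (hu : Tendsto u atTop atTop) (a : ℝ) :
    Tendsto (fun n => (1 + u n) / (a + u n)) atTop (𝓝 1) := by
  have hden : Tendsto (fun n => a + u n) atTop atTop := tendsto_atTop_add_const_left _ _ hu
  have h0 : Tendsto (fun n => (1 - a) / (a + u n)) atTop (𝓝 0) := tendsto_const_nhds.div_atTop hden
  have h1 : Tendsto (fun n => 1 + (1 - a) / (a + u n)) atTop (𝓝 (1 + 0)) := tendsto_const_nhds.add h0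
  rw [add_zero] at h1
  refine h1.congr' ?_
  filter_upwards [hden.eventually_gt_atTop 0] with n hn
  field_simp
  ring

/-- W1 satisfies the integer dilation law S2 at `Δ = 1/2`, for every `k ≥ 1`. -/
theorem dr_integerDilationLaw {h : ℕ → ℝ} {G : Site 3 → ℝ} (hh : ∀ n : ℕ, h n = 1 / (((max n 1 : ℕ) : ℝ) * (1 + Real.log ((max n 1 : ℕ) : ℝ)))) (hG : ∀ x : Site 3, G x = h ⌊Real.sqrt (∑ i, ((x i : ℝ)) ^ 2)⌋₊) :
    (∀ k : ℕ, 1 ≤ k → Tendsto (fun n : ℕ => G (Pi.single 0 ((k * n : ℕ) : ℤ)) * (k : ℝ) ^ (2 * (1 / 2 : ℝ)) / G (Pi.single 0 ((n : ℕ) : ℤ))) atTop (𝓝 1)) := by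
  intro k hk
  have hk0 : (0 : ℝ) < k := by exact_mod_cast hk
  have hlog : Tendsto (fun n : ℕ => Real.log (n : ℝ)) atTop atTop :=
    Real.tendsto_log_atTop.comp tendsto_natCast_atTop_atTop
  have hlim := tendsto_one_add_div_add hlog (1 + Real.log k)
  refine hlim.congr' ?_
  filter_upwards [eventually_ge_atTop 1] with n hn
  have hn0 : (0 : ℝ) < n := by exact_mod_cast hn
  have hkn : 1 ≤ k * n := le_trans hk (Nat.le_mul_of_pos_right k hn)
  rw [lp_single hG, lp_single hG, dr_of_one_le hh hkn, dr_of_one_le hh hn,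
    show (2 : ℝ) * (1 / 2) = 1 by norm_num, Real.rpow_one]
  push_cast
  rw [Real.log_mul hk0.ne' hn0.ne']
  have h1 : 0 < 1 + Real.log k + Real.log n := by
    have := Real.log_nonneg (show (1 : ℝ) ≤ k by exact_mod_cast hk)
    have := Real.log_nonneg (show (1 : ℝ) ≤ n by exact_mod_cast hn)
    linarith
  have h2 : 0 < 1 + Real.log n := by
    have := Real.log_nonneg (show (1 : ℝ) ≤ n by exact_mod_cast hn)
    linarith
  field_simp
  ring

/-! ## What W1 violates -/

/-- **W1 violates T1**: if `G(2^j e₀)(2^j)^{2Δ} → c > 0` then the ratio of consecutive terms tends to `1` and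
equals `2^{2Δ-1}(1 + j log 2)/(1 + (j+1) log 2) → 2^{2Δ-1}`, so `2Δ = 1`; but then the terms are
`1/(1 + j log 2) → 0 ≠ c`. -/
theorem dr_not_dyadicTowerLaw {h : ℕ → ℝ} {G : Site 3 → ℝ} (hh : ∀ n : ℕ, h n = 1 / (((max n 1 : ℕ) : ℝ) * (1 + Real.log ((max n 1 : ℕ) : ℝ)))) (hG : ∀ x : Site 3, G x = h ⌊Real.sqrt (∑ i, ((x i : ℝ)) ^ 2)⌋₊) :
    ¬ (∃ Δ c : ℝ, 0 < c ∧ Tendsto (fun j : ℕ => G (Pi.single 0 ((2 ^ j : ℕ) : ℤ)) * ((2 ^ j : ℕ) : ℝ) ^ (2 * Δ)) atTop (𝓝 c)) := by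
  rintro ⟨Δ, c, hc, hT⟩
  have hL : 0 < Real.log 2 := Real.log_pos one_lt_two
  have e : ∀ j : ℕ, G (Pi.single 0 ((2 ^ j : ℕ) : ℤ)) * ((2 ^ j : ℕ) : ℝ) ^ (2 * Δ) =
      (2 : ℝ) ^ ((2 * Δ - 1) * j) / (1 + j * Real.log 2) := by
    intro j
    rw [lp_single hG, dr_of_one_le hh Nat.one_le_two_pow]
    push_cast
    rw [Real.log_pow, ← Real.rpow_natCast 2 j, ← Real.rpow_mul (by norm_num), sub_mul,
      Real.rpow_sub two_pos, mul_comm (j : ℝ) (2 * Δ), one_mul]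
    have h1 : (0 : ℝ) < (2 : ℝ) ^ (j : ℝ) := by positivity
    have h2 : 0 < 1 + (j : ℝ) * Real.log 2 := by nlinarith [hL, (Nat.cast_nonneg j : (0:ℝ) ≤ j)]
    field_simp
  have hj : Tendsto (fun j : ℕ => (j : ℝ) * Real.log 2) atTop atTop :=
    tendsto_natCast_atTop_atTop.atTop_mul_const hL
  have hratio : Tendsto (fun j : ℕ => (G (Pi.single 0 ((2 ^ (j + 1) : ℕ) : ℤ)) *
      ((2 ^ (j + 1) : ℕ) : ℝ) ^ (2 * Δ)) / (G (Pi.single 0 ((2 ^ j : ℕ) : ℤ)) * ((2 ^ j : ℕ) : ℝ) ^ (2 * Δ)))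
      atTop (𝓝 (c / c)) := (hT.comp (tendsto_add_atTop_nat 1)).div hT hc.ne'
  rw [div_self hc.ne'] at hratio
  have hratio' : Tendsto (fun j : ℕ => (G (Pi.single 0 ((2 ^ (j + 1) : ℕ) : ℤ)) *
      ((2 ^ (j + 1) : ℕ) : ℝ) ^ (2 * Δ)) / (G (Pi.single 0 ((2 ^ j : ℕ) : ℤ)) * ((2 ^ j : ℕ) : ℝ) ^ (2 * Δ)))
      atTop (𝓝 ((2 : ℝ) ^ (2 * Δ - 1) * 1)) := by
    have hq : Tendsto (fun j : ℕ => (1 + (j : ℝ) * Real.log 2) / (1 + Real.log 2 + (j : ℝ) * Real.log 2))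
        atTop (𝓝 1) := tendsto_one_add_div_add hj _
    refine ((tendsto_const_nhds (x := (2 : ℝ) ^ (2 * Δ - 1))).mul hq).congr' ?_
    filter_upwards with j
    rw [e, e]
    push_cast
    rw [mul_add, mul_one, Real.rpow_add two_pos]
    have h1 : (0 : ℝ) < (2 : ℝ) ^ ((2 * Δ - 1) * j) := by positivity
    have h2 : 0 < 1 + (j : ℝ) * Real.log 2 := by nlinarith [hL, (Nat.cast_nonneg j : (0:ℝ) ≤ j)]
    have h3 : 0 < 1 + ((j : ℝ) + 1) * Real.log 2 := by nlinarith [hL, (Nat.cast_nonneg j : (0:ℝ) ≤ j)]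
    field_simp
    ring
  rw [mul_one] at hratio'
  have key : (2 : ℝ) ^ (2 * Δ - 1) = 1 := tendsto_nhds_unique hratio' hratio
  have hΔ : 2 * Δ - 1 = 0 := by
    refine rpow_two_inj ?_
    rw [Real.rpow_zero]
    exact key
  have h0 : Tendsto (fun j : ℕ => G (Pi.single 0 ((2 ^ j : ℕ) : ℤ)) * ((2 ^ j : ℕ) : ℝ) ^ (2 * Δ))
      atTop (𝓝 0) := by
    have := (tendsto_const_nhds (x := (1 : ℝ))).div_atTop (tendsto_atTop_add_const_left _ (1 : ℝ) hj)
    refine this.congr' ?_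
    filter_upwards with j
    rw [e, hΔ, zero_mul, Real.rpow_zero]
  exact hc.ne' (tendsto_nhds_unique hT h0)

/-- Hence W1 violates the crux shape (crux ⇒ D1 ⇒ T1, restriction to the axis and to `n = 2^j`). -/
theorem dr_not_crux {h : ℕ → ℝ} {G : Site 3 → ℝ} (hh : ∀ n : ℕ, h n = 1 / (((max n 1 : ℕ) : ℝ) * (1 + Real.log ((max n 1 : ℕ) : ℝ)))) (hG : ∀ x : Site 3, G x = h ⌊Real.sqrt (∑ i, ((x i : ℝ)) ^ 2)⌋₊) :
    ¬ (∃ Δ c : ℝ, 0 < c ∧ Tendsto (fun x : Site 3 => G x * Real.sqrt (∑ i, ((x i : ℝ)) ^ 2) ^ (2 * Δ)) cofinite (𝓝 c)) := by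
  rintro ⟨Δ, c, hc, hcof⟩
  refine dr_not_dyadicTowerLaw hh hG ⟨Δ, c, hc, ?_⟩
  have hax : Tendsto (fun n : ℕ => G (Pi.single 0 ((n : ℕ) : ℤ)) * (n : ℝ) ^ (2 * Δ)) atTop (𝓝 c) := by
    refine (tendsto_axis_of_cofinite hcof).congr fun n => ?_
    simp only [sqrt_sum_sq_single_nat]
  exact hax.comp (tendsto_pow_atTop_atTop_of_one_lt one_lt_two)

/-! ## The separations (F3) -/

/-- **F3a — T1 is not implied by S2 ∧ S3 ∧ A ∧ envelope ∧ symmetry ∧ positivity.** For functions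
`G : ℤ³ → ℝ`: positivity, cubic symmetry, the envelope, the integer dilation law S2 (at some exponent), ratio
isotropy S3 and A (`Ψ ≡ 1`) together do NOT imply the dyadic tower law T1 (witness W1, S2 at `Δ = 1/2`).
[folklore: slowly varying / logarithmic gauge] -/
theorem dr_dyadicTowerLaw_not_of_dilation_isotropy_envelope :
    ¬ ∀ G : Site 3 → ℝ, (∀ x, 0 < G x) →
      (∀ (σ : Equiv.Perm (Fin 3)) (ε : Fin 3 → ℤ), (∀ i, ε i = 1 ∨ ε i = -1) → ∀ x, G (fun i => ε i * x (σ i)) = G x) →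
      (∃ c C : ℝ, 0 < c ∧ ∀ x : Site 3, x ≠ 0 → c * (‖x‖ : ℝ) ^ (-(2 : ℝ)) ≤ G x ∧ G x ≤ C * (‖x‖ : ℝ) ^ (-(1 : ℝ))) →
      (∃ Δ : ℝ, (∀ k : ℕ, 1 ≤ k → Tendsto (fun n : ℕ => G (Pi.single 0 ((k * n : ℕ) : ℤ)) * (k : ℝ) ^ (2 * Δ) / G (Pi.single 0 ((n : ℕ) : ℤ))) atTop (𝓝 1))) →
      Tendsto (fun x : Site 3 => G x / G (Pi.single 0 ((⌊Real.sqrt (∑ i, ((x i : ℝ)) ^ 2)⌋₊ : ℕ) : ℤ))) cofinite (𝓝 1) →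
      Tendsto (fun x : Site 3 => G x / G (Pi.single 0 ((⌊Real.sqrt (∑ i, ((x i : ℝ)) ^ 2)⌋₊ : ℕ) : ℤ)) - (fun _ : Fin 3 → ℝ => (1 : ℝ)) (fun i => (x i : ℝ) / Real.sqrt (∑ j, ((x j : ℝ)) ^ 2))) cofinite (𝓝 0) →
      (∃ Δ c : ℝ, 0 < c ∧ Tendsto (fun j : ℕ => G (Pi.single 0 ((2 ^ j : ℕ) : ℤ)) * ((2 ^ j : ℕ) : ℝ) ^ (2 * Δ)) atTop (𝓝 c)) := by
  intro hall
  set h : ℕ → ℝ := fun n => 1 / (((max n 1 : ℕ) : ℝ) * (1 + Real.log ((max n 1 : ℕ) : ℝ))) with hh_def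
  set G : Site 3 → ℝ := fun x => h ⌊Real.sqrt (∑ i, ((x i : ℝ)) ^ 2)⌋₊ with hG_def
  have hh : ∀ n : ℕ, h n = 1 / (((max n 1 : ℕ) : ℝ) * (1 + Real.log ((max n 1 : ℕ) : ℝ))) := fun n => rfl
  have hG : ∀ x : Site 3, G x = h ⌊Real.sqrt (∑ i, ((x i : ℝ)) ^ 2)⌋₊ := fun x => rfl
  exact dr_not_dyadicTowerLaw hh hG (hall G (dr_G_pos hh hG) (lp_G_symm hG) (dr_envelope hh hG)
    ⟨1 / 2, dr_integerDilationLaw hh hG⟩ (dr_ratioIsotropy hh hG) (dr_angularProfile hh hG))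

/-- **F3b — the crux shape is not implied by S2 ∧ S3 ∧ A ∧ envelope ∧ symmetry ∧ positivity** (witness W1).
[folklore] -/
theorem dr_crux_not_of_dilation_isotropy_envelope :
    ¬ ∀ G : Site 3 → ℝ, (∀ x, 0 < G x) →
      (∀ (σ : Equiv.Perm (Fin 3)) (ε : Fin 3 → ℤ), (∀ i, ε i = 1 ∨ ε i = -1) → ∀ x, G (fun i => ε i * x (σ i)) = G x) →
      (∃ c C : ℝ, 0 < c ∧ ∀ x : Site 3, x ≠ 0 → c * (‖x‖ : ℝ) ^ (-(2 : ℝ)) ≤ G x ∧ G x ≤ C * (‖x‖ : ℝ) ^ (-(1 : ℝ))) →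
      (∃ Δ : ℝ, (∀ k : ℕ, 1 ≤ k → Tendsto (fun n : ℕ => G (Pi.single 0 ((k * n : ℕ) : ℤ)) * (k : ℝ) ^ (2 * Δ) / G (Pi.single 0 ((n : ℕ) : ℤ))) atTop (𝓝 1))) →
      Tendsto (fun x : Site 3 => G x / G (Pi.single 0 ((⌊Real.sqrt (∑ i, ((x i : ℝ)) ^ 2)⌋₊ : ℕ) : ℤ))) cofinite (𝓝 1) →
      Tendsto (fun x : Site 3 => G x / G (Pi.single 0 ((⌊Real.sqrt (∑ i, ((x i : ℝ)) ^ 2)⌋₊ : ℕ) : ℤ)) - (fun _ : Fin 3 → ℝ => (1 : ℝ)) (fun i => (x i : ℝ) / Real.sqrt (∑ j, ((x j : ℝ)) ^ 2))) cofinite (𝓝 0) →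
      (∃ Δ c : ℝ, 0 < c ∧ Tendsto (fun x : Site 3 => G x * Real.sqrt (∑ i, ((x i : ℝ)) ^ 2) ^ (2 * Δ)) cofinite (𝓝 c)) := by
  intro hall
  set h : ℕ → ℝ := fun n => 1 / (((max n 1 : ℕ) : ℝ) * (1 + Real.log ((max n 1 : ℕ) : ℝ))) with hh_def
  set G : Site 3 → ℝ := fun x => h ⌊Real.sqrt (∑ i, ((x i : ℝ)) ^ 2)⌋₊ with hG_def
  have hh : ∀ n : ℕ, h n = 1 / (((max n 1 : ℕ) : ℝ) * (1 + Real.log ((max n 1 : ℕ) : ℝ))) := fun n => rfl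
  have hG : ∀ x : Site 3, G x = h ⌊Real.sqrt (∑ i, ((x i : ℝ)) ^ 2)⌋₊ := fun x => rfl
  exact dr_not_crux hh hG (hall G (dr_G_pos hh hG) (lp_G_symm hG) (dr_envelope hh hG)
    ⟨1 / 2, dr_integerDilationLaw hh hG⟩ (dr_ratioIsotropy hh hG) (dr_angularProfile hh hG))

end Summit.CriticalPhenomena.Ising3DConformalLimit.Theorems.IsingEuclidUpgradeR2RotInvPowerLaw.Negative

end
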